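import Literature.NumberTheory.EllipticCurves.BSDQuadraticDescentTorsionOddPartProofs
import HarnessLib

/-!
# Class X11b, route p2: the algebra of Greenberg's Lemma 3.3 EXACT — the snake identity
# `[B : ψB] · #(T ⊓ ker ψ) = [T : ψT] · #ker ψ` and the `p`-primary purity count
# `#G[p^∞] = #G₀[p^∞] · p ^ ord_p [G : G₀]` (cell `b2b-bsdres`, sub-cell `multr1-p2`, gen 20)

HONEST FRAMING (verbatim, cell `b2b-bsdres`): the goal of the cell is to DELETE the
COMBINATION-SHAPED residual classes for ALL analytic-rank `≤ 1` curves over `ℚ` — "full BSD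
formula for every rank `≤ 1` curve in class `C`" assembled STRICTLY from published theorems — so
that the rank-`≤ 1` remainder becomes exactly the CONSTRUCTION-SHAPED classes, which are TYPED
(missing-input Props), NOT attempted; this is not "finishing BSD". Research route `p2` for class
X11b; no claim beyond the stated class; nothing booked; X11b stays CONSTRUCTION-SHAPED. Pure
algebra; theorems only; no definition, no named fact, no `sorry`. Continues
`BDPRouteLocalKernelAlgebra.lean` (gen 13: the INEQUALITY `#(B/φ(B)) ≤ p ^ ord_p [ker φ : ker φ ⊓ M₀]`).

## Why this file

Gens 13–14 proved Greenberg's Lemma 3.3 at a place `v ∤ p` as an INEQUALITY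
`#ker r_v ≤ c_v^{(p)}` (`natCard_localKer_le_pow_padicValNat_localTamagawaNumber`). Route R1's
atom (P11) `LocalKernelOrderAt` (JSW17 Prop. 3.3.4 Case 1(a) = Greenberg LNM 1716 pp. 74–75) and
the `=`-form of the control theorem want the EQUALITY `#ker r_v = c_v^{(p)}` at finitely decomposed
`v`. The sibling sub-cell (`ProcyclicDescentKernel`, multr1-p1 gen 17) reduced the equality to "the
arithmetic identity `#(B_v/(γ_v − 1)B_v) = c_v^{(p)}`". This file is the ALGEBRA of that identity;
the arithmetic (`#E(K_v)[p^∞] = #E₀(K_v)[p^∞] · c_v^{(p)}` and the transport to `B_v`) is in the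
companion files `BDPRouteLocalTorsionPurity.lean` / `BDPRouteLocalKernelExact.lean`.

## Content (pure algebra, `Nat.card`/`AddSubgroup.index` with their junk value `0` for "infinite")

* **`index_range_mul_card_inf_ker_eq`** — for an endomorphism `ψ` of an abelian group `B` and a
  `ψ`-stable subgroup `T` of FINITE index (with `ψT = ψ|_T`):
  `[B : ψ(B)] · #(T ⊓ ker ψ) = [T : ψ(T)] · #ker ψ`.
  This is the alternating product of the six-term kernel–cokernel sequence of `ψ` on
  `0 → T → B → B/T → 0` (`#ker ψ̄ = #coker ψ̄` on the finite `B/T`), proved here by index calculus: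
  `[B : ψT] = [B : ψB]·[ψB : ψT] = [B : T]·[T : ψT]`, `[ψB : ψT] = [B : T + ker ψ]`,
  `[T + ker ψ : T] = [ker ψ : T ⊓ ker ψ]`. No finiteness of `ker ψ` or of the cokernels is needed.
* `finite_quotient_range_of_finite` — hence `B/ψ(B)` is finite as soon as `T/ψ(T)` and `ker ψ` are.
* **`natCard_primaryComponent_eq_pow_of_divisible`** — if `U ≤ G` has finite index, is
  `p`-divisible and has no `p`-torsion, then `G[p^∞]` is finite of order `p ^ ord_p [G : U]`
  (`G[p^∞] → (G/U)[p^∞]` is a bijection; `#(G/U)[p^∞] = p ^ ord_p #(G/U)`, tree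
  `natCard_primaryComponent_eq_pow_padicValNat`).
* **`natCard_primaryComponent_eq_mul_pow_of_divisible_le`** — with `U ≤ G₀ ≤ G` as above:
  `#G[p^∞] = #G₀[p^∞] · p ^ ord_p [G : G₀]`. Intended: `G = E(K_v)`, `G₀ = E₀(K_v)`,
  `U = E₁(K_v)` (`p`-divisible and `p`-torsion-free for `v ∤ p`, Silverman *AEC* IV.2.3, VII.3.1),
  `[G : G₀] = c_v` (Kodaira–Néron): `#E(K_v)[p^∞] = #E₀(K_v)[p^∞] · c_v^{(p)}`.

CONDITIONAL use only (inputs of the (P11)/control-`=` programme); nothing booked; labels unchanged.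

References: [GreenbergLNM1716] §3 Lemma 3.3 (p. 87), §4 proof of Thm. 4.1 (p. 74: "`ker r_v` has
order `c_v^{(p)}`"); [SilvermanAEC2009] IV.2.3, VII.2.1, VII.3.1, VII.6.1.
-/

namespace Summit.BirchSwinnertonDyer.Rank1Residual.X11b.TamagawaCoinvariants

/-! ## The snake identity `[B : ψB] · #(T ⊓ ker ψ) = [T : ψT] · #ker ψ` -/

section Snake

variable {B : Type*} [AddCommGroup B]

/-- `ψ⁻¹(ψ(T))` has index `[ψ(B) : ψ(T)]`: the relative index of `ψ(T)` in `ψ(B)` is the index of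
`T ⊔ ker ψ` in `B` (pull back along the surjection `B ↠ ψ(B)`). [folklore] -/
theorem relIndex_map_range_eq_index_sup_ker (ψ : B →+ B) (T : AddSubgroup B) :
    (T.map ψ).relIndex ψ.range = (T ⊔ ψ.ker).index := by
  have hsurj := AddMonoidHom.rangeRestrict_surjective ψ
  have hcomap : ((T.map ψ).addSubgroupOf ψ.range).comap ψ.rangeRestrict = T ⊔ ψ.ker := by
    rw [← AddSubgroup.comap_map_eq]
    ext b
    simp only [AddSubgroup.mem_comap, AddSubgroup.mem_addSubgroupOf, AddMonoidHom.coe_rangeRestrict]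
  rw [AddSubgroup.relIndex, ← AddSubgroup.index_comap_of_surjective _ hsurj, hcomap]

/-- For a `ψ`-stable `T`, the relative index of `ψ(T)` in `T` is the index of the range of the
restriction `ψT = ψ|_T`. [folklore] -/
theorem relIndex_map_eq_index_range (ψ : B →+ B) (T : AddSubgroup B) (ψT : T →+ T)
    (hψT : ∀ t, (ψT t : B) = ψ t) : (T.map ψ).relIndex T = ψT.range.index := by
  have h : (T.map ψ).addSubgroupOf T = ψT.range := by
    ext t
    simp only [AddSubgroup.mem_addSubgroupOf, AddSubgroup.mem_map, AddMonoidHom.mem_range]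
    constructor
    · rintro ⟨t', ht', h⟩
      exact ⟨⟨t', ht'⟩, Subtype.ext (by rw [hψT]; exact h)⟩
    · rintro ⟨t', h⟩
      exact ⟨t', t'.2, by rw [← hψT, h]⟩
  rw [AddSubgroup.relIndex, h]

/-- **The snake identity.** For an endomorphism `ψ` of an abelian group `B` and a `ψ`-stable
subgroup `T` of finite index, with `ψT = ψ|_T`:
`[B : ψ(B)] · #(T ⊓ ker ψ) = [T : ψ(T)] · #ker ψ` (indices and cardinalities as natural numbers,
`0` standing for "infinite"). This is the alternating product of the exact kernel–cokernel sequence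
`0 → ker ψT → ker ψ → ker ψ̄ → T/ψT → B/ψB → (B/T)/ψ̄ → 0` of `ψ` on `0 → T → B → B/T → 0` with
`#ker ψ̄ = #coker ψ̄` (`B/T` finite); proved by index calculus. Intended: `B = B_v`, `ψ = γ_v − 1`,
`T = B_v ∩ E₀`. [cite: GreenbergLNM1716, §3 Lemma 3.3 (proof, p. 87)] -/
theorem index_range_mul_card_inf_ker_eq (ψ : B →+ B) (T : AddSubgroup B) [T.FiniteIndex]
    (ψT : T →+ T) (hψT : ∀ t, (ψT t : B) = ψ t) :
    ψ.range.index * Nat.card ↥(T ⊓ ψ.ker) = ψT.range.index * Nat.card ψ.ker := by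
  -- `S = ψ(T) ≤ ψ(B)` and `≤ T`
  have hSr : T.map ψ ≤ ψ.range := AddSubgroup.map_le_range ψ T
  have hST : T.map ψ ≤ T := by
    rintro _ ⟨t, ht, rfl⟩
    rw [← hψT ⟨t, ht⟩]
    exact (ψT ⟨t, ht⟩).2
  have hi : T.index ≠ 0 := AddSubgroup.FiniteIndex.index_ne_zero
  -- (E1) `[ψB : ψT]·[B : ψB] = [S : B] = [T : ψT]·[B : T]`
  have e1 : (T ⊔ ψ.ker).index * ψ.range.index = ψT.range.index * T.index := by
    rw [← relIndex_map_range_eq_index_sup_ker, ← relIndex_map_eq_index_range ψ T ψT hψT,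
      AddSubgroup.relIndex_mul_index hSr, AddSubgroup.relIndex_mul_index hST]
  -- (E2) `[ker ψ : T ⊓ ker ψ]·[B : T + ker ψ] = [B : T]`
  have e2 : T.relIndex ψ.ker * (T ⊔ ψ.ker).index = T.index := by
    rw [← AddSubgroup.relIndex_sup_left (K := T) (H := ψ.ker)]
    exact AddSubgroup.relIndex_mul_index le_sup_left
  -- (E3) `#(T ⊓ ker ψ)·[ker ψ : T ⊓ ker ψ] = #ker ψ`
  have e3 : Nat.card ↥(T ⊓ ψ.ker) * T.relIndex ψ.ker = Nat.card ψ.ker := by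
    rw [← AddSubgroup.relIndex_bot_left, ← AddSubgroup.relIndex_bot_left,
      ← AddSubgroup.inf_relIndex_right T ψ.ker]
    exact AddSubgroup.relIndex_mul_relIndex ⊥ (T ⊓ ψ.ker) ψ.ker bot_le inf_le_right
  -- cancel `[B : T] ≠ 0`: `[B : ψB] = [T : ψT]·[ker ψ : T ⊓ ker ψ]`
  have hr : T.relIndex ψ.ker ≠ 0 := by
    intro h0; rw [h0, zero_mul] at e2; exact hi e2.symm
  have e4 : ψ.range.index = ψT.range.index * T.relIndex ψ.ker := by
    have h2 : T.index * ψ.range.index = T.index * (ψT.range.index * T.relIndex ψ.ker) := by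
      calc T.index * ψ.range.index
          = T.relIndex ψ.ker * (T ⊔ ψ.ker).index * ψ.range.index := by rw [e2]
        _ = T.relIndex ψ.ker * ((T ⊔ ψ.ker).index * ψ.range.index) := by rw [mul_assoc]
        _ = T.relIndex ψ.ker * (ψT.range.index * T.index) := by rw [e1]
        _ = T.index * (ψT.range.index * T.relIndex ψ.ker) := by ring
    exact Nat.eq_of_mul_eq_mul_left (Nat.pos_of_ne_zero hi) h2
  rw [e4, mul_assoc, mul_comm (T.relIndex ψ.ker), e3]

/-- The snake identity with quotients: `#(B/ψB) · #(T ⊓ ker ψ) = #(T/ψT) · #ker ψ`.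
[cite: GreenbergLNM1716, §3 Lemma 3.3 (proof, p. 87)] -/
theorem natCard_quotient_range_mul_card_inf_ker_eq (ψ : B →+ B) (T : AddSubgroup B)
    [T.FiniteIndex] (ψT : T →+ T) (hψT : ∀ t, (ψT t : B) = ψ t) :
    Nat.card (B ⧸ ψ.range) * Nat.card ↥(T ⊓ ψ.ker) = Nat.card (T ⧸ ψT.range) * Nat.card ψ.ker := by
  rw [← AddSubgroup.index_eq_card, ← AddSubgroup.index_eq_card]
  exact index_range_mul_card_inf_ker_eq ψ T ψT hψT

/-- **Finiteness transfer**: if `T/ψ(T)` and `ker ψ` are finite (and `[B : T] < ∞`), then `B/ψ(B)`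
is finite. [folklore] -/
theorem finite_quotient_range_of_finite (ψ : B →+ B) (T : AddSubgroup B) [T.FiniteIndex]
    (ψT : T →+ T) (hψT : ∀ t, (ψT t : B) = ψ t) [Finite (T ⧸ ψT.range)] [Finite ψ.ker] :
    Finite (B ⧸ ψ.range) := by
  have h := index_range_mul_card_inf_ker_eq ψ T ψT hψT
  have hT : ψT.range.index ≠ 0 := AddSubgroup.index_ne_zero_of_finite
  have hk : Nat.card ψ.ker ≠ 0 := Nat.card_pos.ne'
  have hne : ψ.range.index ≠ 0 := by
    intro h0
    rw [h0, zero_mul] at h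
    exact (mul_ne_zero hT hk) h.symm
  haveI : ψ.range.FiniteIndex := ⟨hne⟩
  exact AddSubgroup.finite_quotient_of_finiteIndex

/-- **Divisibility form**: `[T : ψT] · #ker ψ / #(T ⊓ ker ψ)` divides nothing new — but when
`#ker ψ = #(T ⊓ ker ψ) · m`, the snake identity reads `[B : ψB] = [T : ψT] · m` (for `ker ψ`
finite). [folklore] -/
theorem index_range_eq_mul_of_card_ker_eq (ψ : B →+ B) (T : AddSubgroup B) [T.FiniteIndex]
    (ψT : T →+ T) (hψT : ∀ t, (ψT t : B) = ψ t) [Finite ψ.ker] {m : ℕ}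
    (hm : Nat.card ψ.ker = Nat.card ↥(T ⊓ ψ.ker) * m) :
    ψ.range.index = ψT.range.index * m := by
  have h := index_range_mul_card_inf_ker_eq ψ T ψT hψT
  haveI : Finite ↥(T ⊓ ψ.ker) := Finite.of_injective _ (AddSubgroup.inclusion_injective inf_le_right)
  have hc : Nat.card ↥(T ⊓ ψ.ker) ≠ 0 := Nat.card_pos.ne'
  rw [hm, mul_comm (Nat.card ↥(T ⊓ ψ.ker)) m, ← mul_assoc] at h
  exact Nat.eq_of_mul_eq_mul_right (Nat.pos_of_ne_zero hc) h

end Snake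

/-! ## The `p`-primary purity count `#G[p^∞] = #G₀[p^∞] · p ^ ord_p [G : G₀]` -/

section Purity

variable {G : Type*} [AddCommGroup G] (p : ℕ)

/-- Iterated `p`-division inside a `p`-divisible subgroup. [folklore] -/
theorem exists_pow_nsmul_eq_of_divisible (U : AddSubgroup G)
    (hdiv : ∀ u ∈ U, ∃ u' ∈ U, p • u' = u) (k : ℕ) {u : G} (hu : u ∈ U) :
    ∃ u' ∈ U, p ^ k • u' = u := by
  induction k generalizing u with
  | zero => exact ⟨u, hu, by rw [pow_zero, one_smul]⟩
  | succ k ih =>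
    obtain ⟨u₁, hu₁, rfl⟩ := hdiv u hu
    obtain ⟨u₂, hu₂, rfl⟩ := ih hu₁
    exact ⟨u₂, hu₂, by rw [pow_succ, mul_smul, smul_comm]⟩

/-- No `p`-torsion implies no `p`-power torsion. [folklore] -/
theorem eq_zero_of_pow_nsmul_eq_zero_of_torsionFree (U : AddSubgroup G)
    (htf : ∀ u ∈ U, p • u = 0 → u = 0) (k : ℕ) {u : G} (hu : u ∈ U) (hk : p ^ k • u = 0) :
    u = 0 := by
  induction k generalizing u with
  | zero => rwa [pow_zero, one_smul] at hk
  | succ k ih =>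
    rw [pow_succ, mul_smul] at hk
    have h1 : p • u = 0 := ih (U.nsmul_mem hu p) hk
    exact htf u hu h1

/-- **`G[p^∞] ≅ (G/U)[p^∞]` for a `p`-divisible, `p`-torsion-free `U`**: the quotient map restricted
to the `p`-primary component is a bijection onto the `p`-primary component of `G/U`. [folklore] -/
theorem bijective_primaryComponent_quotient_of_divisible (U : AddSubgroup G)
    (hdiv : ∀ u ∈ U, ∃ u' ∈ U, p • u' = u) (htf : ∀ u ∈ U, p • u = 0 → u = 0) :
    Function.Bijective (fun g : AddCommGroup.primaryComponent G p ↦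
      (⟨QuotientAddGroup.mk (s := U) (g : G), by
        obtain ⟨k, hk⟩ := (AddCommGroup.mem_primaryComponent).mp g.2
        exact (AddCommGroup.mem_primaryComponent).mpr ⟨k, by
          rw [← QuotientAddGroup.mk_nsmul, hk, QuotientAddGroup.mk_zero]⟩⟩ :
        AddCommGroup.primaryComponent (G ⧸ U) p)) := by
  constructor
  · intro a b hab
    have h : (QuotientAddGroup.mk (s := U) (a : G)) = QuotientAddGroup.mk (b : G) :=
      congrArg Subtype.val hab
    rw [QuotientAddGroup.eq_iff_sub_mem] at h
    obtain ⟨ka, hka⟩ := (AddCommGroup.mem_primaryComponent).mp a.2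
    obtain ⟨kb, hkb⟩ := (AddCommGroup.mem_primaryComponent).mp b.2
    have hk : p ^ (ka + kb) • ((a : G) - b) = 0 := by
      rw [smul_sub, pow_add, mul_comm, mul_smul, hka, smul_zero, mul_comm, mul_smul, hkb,
        smul_zero, sub_self]
    exact Subtype.ext (sub_eq_zero.mp
      (eq_zero_of_pow_nsmul_eq_zero_of_torsionFree p U htf (ka + kb) h hk))
  · rintro ⟨q, hq⟩
    obtain ⟨k, hk⟩ := (AddCommGroup.mem_primaryComponent).mp hq
    induction q using QuotientAddGroup.induction_on with
    | H g =>
      have hmem : p ^ k • g ∈ U := by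
        rw [← QuotientAddGroup.eq_zero_iff, QuotientAddGroup.mk_nsmul]; exact hk
      obtain ⟨u, hu, hu'⟩ := exists_pow_nsmul_eq_of_divisible p U hdiv k hmem
      refine ⟨⟨g - u, (AddCommGroup.mem_primaryComponent).mpr ⟨k, by rw [smul_sub, hu', sub_self]⟩⟩,
        Subtype.ext ?_⟩
      change QuotientAddGroup.mk (s := U) (g - u) = QuotientAddGroup.mk g
      rw [QuotientAddGroup.mk_sub, (QuotientAddGroup.eq_zero_iff u).mpr hu, sub_zero]

/-- **`#G[p^∞] = p ^ ord_p [G : U]`** for a `p`-divisible, `p`-torsion-free subgroup `U` of finite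
index; in particular `G[p^∞]` is finite. Intended: `G = E(K_v)` (or `E₀(K_v)`), `U = E₁(K_v)`,
`v ∤ p`. [cite: SilvermanAEC2009, Prop. VII.3.1 with IV.2.3 and Cor. VII.6.2] -/
theorem natCard_primaryComponent_eq_pow_of_divisible [Fact p.Prime] (U : AddSubgroup G) [U.FiniteIndex]
    (hdiv : ∀ u ∈ U, ∃ u' ∈ U, p • u' = u) (htf : ∀ u ∈ U, p • u = 0 → u = 0) :
    Finite (AddCommGroup.primaryComponent G p) ∧
      Nat.card (AddCommGroup.primaryComponent G p) = p ^ padicValNat p U.index := by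
  have hbij := bijective_primaryComponent_quotient_of_divisible p U hdiv htf
  haveI : Finite (G ⧸ U) := AddSubgroup.finite_quotient_of_finiteIndex
  haveI : Finite (AddCommGroup.primaryComponent (G ⧸ U) p) := inferInstance
  refine ⟨Finite.of_injective _ hbij.1, ?_⟩
  rw [Nat.card_eq_of_bijective _ hbij,
    Literature.NumberTheory.EllipticCurves.natCard_primaryComponent_eq_pow_padicValNat p,
    AddSubgroup.index_eq_card]

/-- **The purity count `#G[p^∞] = #G₀[p^∞] · p ^ ord_p [G : G₀]`** whenever some `U ≤ G₀` of
finite index in `G` is `p`-divisible and `p`-torsion-free. Intended: `G = E(K_v)`, `G₀ = E₀(K_v)`,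
`U = E₁(K_v)` at `v ∤ p`, `[G : G₀] = c_v` (Kodaira–Néron): `#E(K_v)[p^∞] = #E₀(K_v)[p^∞] · c_v^{(p)}`.
[cite: SilvermanAEC2009, Prop. VII.3.1, IV.2.3, Cor. VII.6.2, Thm. VII.6.1]
[cite: GreenbergLNM1716, §4 proof of Thm. 4.1 (p. 74)] -/
theorem natCard_primaryComponent_eq_mul_pow_of_divisible_le [Fact p.Prime] (G₀ U : AddSubgroup G)
    (hU : U ≤ G₀)
    [U.FiniteIndex] (hdiv : ∀ u ∈ U, ∃ u' ∈ U, p • u' = u) (htf : ∀ u ∈ U, p • u = 0 → u = 0) :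
    Finite (AddCommGroup.primaryComponent G p) ∧
      Nat.card (AddCommGroup.primaryComponent G p) =
        Nat.card (AddCommGroup.primaryComponent G₀ p) * p ^ padicValNat p G₀.index := by
  obtain ⟨hfin, hG⟩ := natCard_primaryComponent_eq_pow_of_divisible p U hdiv htf
  -- `U` as a subgroup of `G₀`
  let U₀ : AddSubgroup G₀ := U.addSubgroupOf G₀
  haveI : U₀.FiniteIndex := by
    change (U.addSubgroupOf G₀).FiniteIndex; infer_instance
  have hdiv₀ : ∀ u ∈ U₀, ∃ u' ∈ U₀, p • u' = u := by
    intro u hu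
    obtain ⟨u', hu', h⟩ := hdiv (u : G) (AddSubgroup.mem_addSubgroupOf.mp hu)
    exact ⟨⟨u', hU hu'⟩, AddSubgroup.mem_addSubgroupOf.mpr hu', Subtype.ext h⟩
  have htf₀ : ∀ u ∈ U₀, p • u = 0 → u = 0 := fun u hu h ↦
    Subtype.ext (htf (u : G) (AddSubgroup.mem_addSubgroupOf.mp hu) (congrArg Subtype.val h))
  obtain ⟨-, hG₀⟩ := natCard_primaryComponent_eq_pow_of_divisible p U₀ hdiv₀ htf₀
  refine ⟨hfin, ?_⟩
  have hidx : U.index = U.relIndex G₀ * G₀.index := (AddSubgroup.relIndex_mul_index hU).symm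
  have h1 : U.relIndex G₀ ≠ 0 := by
    intro h0; rw [h0, zero_mul] at hidx; exact AddSubgroup.FiniteIndex.index_ne_zero hidx
  have h2 : G₀.index ≠ 0 := by
    intro h0; rw [h0, mul_zero] at hidx; exact AddSubgroup.FiniteIndex.index_ne_zero hidx
  rw [hG, hG₀, hidx, padicValNat.mul h1 h2, pow_add]
  rfl

end Purity

end Summit.BirchSwinnertonDyer.Rank1Residual.X11b.TamagawaCoinvariants
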